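import Summits.QuantumFields.BalabanUV.T4Continuum.Support.VariationalColourTaxiTowerRuns

/-!
# T⁴ programme, spine node NE2 (U1a), lane P2 — «V-COL-TAXI-TOWER», part 3: MERGING TWO TAXIS — the coarse taxi (legs of `L·j₂ᵢ` fine bonds) followed by the fine
# taxi inside the target site (legs `j₁ᵢ`) is the straight taxi with legs `L·j₂ᵢ + j₁ᵢ` up to `Σ_{i<i″} j₁ᵢ·L j₂ᵢ″·a`, bounded here crudely by `d²·L(n−1)(L−1)·a` —
# each fine leg is moved left past the later coarse legs through `j₁ᵢ × L j₂ᵢ″` rectangles, same-direction legs merge exactly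

NE2 formalisation swarm `b2b-balaban-t4-ne2-formalise-*`, leaf prover 04 GEN 4 (`prover-b2b-balaban-t4-ne2-formalise-leaf-04-g4-0`); register row «P2-sup» of
`t4/formal/NE2/LEAVES.md`; journal CLAIMS.log «V-COL-TAXI-TOWER».  On top of parts 1–2 (`piTv_coarseTv_eq`, `bpt_add_tstep_mul`) and «V-COL-TAXI» part 1 (`taxiAcc`,
`legTv`, `corner`, `below`) — the second building block of invariant (E_k) (part 4: the assembly over `compL`).
 * §1 `outerLeg` ∕ `outerRest` (the coarse legs read as fine runs from an in-block offset `b`, products of consecutive ones), `mergedLeg` ∕ `mergedAcc` (legs `L·j₂ᵢ + j₁ᵢ`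
   from the offset `below j₁ i`), `taxiAcc_coarse_eq_outerRest` (the coarse taxi IS `outerRest` at offset `0`, by `piTv_coarseTv_eq`);
 * §2 **`outerRest_mul_innerLeg_sub_le`**: the fine leg `i` (`j₁ᵢ` bonds) moves left past the coarse legs `i+1, …` (each an `L j₂ᵢ″ × j₁ᵢ` rectangle, the offset advancing from
   `below j₁ i` to `below j₁ (i+1)`); `outer_mul_innerAcc_sub_le` (prefix form, `≤ i·d·L(n−1)(L−1)·a`); **`outer_mul_inner_sub_mergedAcc_le`**:
   `‖taxiAcc n M (coarseTv S) y j₂ d ∘ taxiAcc L (fine n M) S (n·y + j₂) j₁ d − mergedAcc S y j₂ j₁ d‖ ≤ d·d·L(n−1)(L−1)·a` (crude count: each of the `d` steps costs at most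
   `d·L(n−1)(L−1)·a`).
WHAT IS NOT HERE (stated, not hidden): the identification of `mergedAcc … d` with the straight taxi `taxiTv (n·L) M (Rtrv S)` of the composite torus (one `sites` lemma per
leg, part 4), invariant (E_k) (part 4), the END.

HONEST FRAMING (T4-DAG p. 1).  Ordered-product bookkeeping at MODEL level (bond operators DATA; taxi ∕ straight contours OURS; SHAPES only, no B0, c5); [folklore];
nothing printed is a hypothesis; data `def`s `outerLeg` ∕ `outerRest` ∕ `mergedLeg` ∕ `mergedAcc` only, no `def … : Prop`, no `sorry`; axioms standard.  NE2 NOT proved on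
either road; NE3 OPEN; spine PROVED 0∕9 unchanged; rung (B)+1 finite T⁴ — NOT infinite volume, NOT mass gap, NOT Clay.  HONEST DEPENDENCY (cell, verbatim): continuum YM
on T⁴ ⇐ BetaPertH ∧ nine spine estimates (0/9 proved); BetaPertH ⇐ (D1) ∧ (D4) ∧ CAP+tail; G-an2-4 gates asym, D1 and NE2/3/4.
-/

noncomputable section

namespace Summit.QuantumFields.BalabanUV.T4Continuum.VariationalColourTaxiTransport

open Literature.MathematicalPhysics.QuantumFieldTheory.Balaban1983to89.B5Prop11Plancherel (Tor fine unitVec)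
open Literature.MathematicalPhysics.QuantumFieldTheory.Balaban1983to89.B5Block118 (tstep tstep_zero tstep_succ bpt bpt_add_tstep)
open Summit.QuantumFields.BalabanUV.T4Continuum.ScalarBlockTrialFunction (bpt_update')
open Summit.QuantumFields.BalabanUV.T4Continuum.VariationalTaxiTransport (below corner corner_succ corner_d below_succ)
open Summit.QuantumFields.BalabanUV.T4Continuum.VariationalTaxiCoarse (corner_zero)
open Summit.QuantumFields.BalabanUV.T4Continuum.VariationalColourFederbush (piTv norm_piTv_le_one)
open Summit.QuantumFields.BalabanUV.T4Continuum.VariationalVectorFederbush (norm_piTv_comm_sub_le)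

variable {d : ℕ} {E : Type*} [NormedAddCommGroup E] [NormedSpace ℂ E]
variable (L n : ℕ) [NeZero L] [NeZero n] (M : Fin d → ℕ) [hM : ∀ μ, NeZero (M μ)]

/-! ## §1 The coarse legs as fine runs, the merged legs -/

/-- the `i`-th COARSE leg read as a fine run of `L·j₂ᵢ` bonds from the in-block offset `b` of the coarse corner site. [folklore] -/
def outerLeg (S : Tor (fine L (fine n M)) → Fin d → (E →L[ℂ] E)) (y : Tor M) (j₂ : Fin d → Fin n) (b : Fin d → Fin L) (i : ℕ) : E →L[ℂ] E :=
  if h : i < d then piTv L (fine n M) S (bpt L (fine n M) (corner n M y j₂ i) b) ⟨i, h⟩ (L * (j₂ ⟨i, h⟩ : ℕ)) else 1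

/-- the ordered product of the coarse legs `i, i+1, …, i+m−1` at offset `b` (leg `i` leftmost). [folklore] -/
def outerRest (S : Tor (fine L (fine n M)) → Fin d → (E →L[ℂ] E)) (y : Tor M) (j₂ : Fin d → Fin n) (b : Fin d → Fin L) : ℕ → ℕ → (E →L[ℂ] E)
  | _, 0 => 1
  | i, m + 1 => outerLeg L n M S y j₂ b i * outerRest S y j₂ b (i + 1) m

/-- the `i`-th MERGED leg: `L·j₂ᵢ + j₁ᵢ` fine bonds from the offset `below j₁ i` of the coarse corner site. [folklore] -/
def mergedLeg (S : Tor (fine L (fine n M)) → Fin d → (E →L[ℂ] E)) (y : Tor M) (j₂ : Fin d → Fin n) (j₁ : Fin d → Fin L) (i : ℕ) : E →L[ℂ] E :=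
  if h : i < d then piTv L (fine n M) S (bpt L (fine n M) (corner n M y j₂ i) (below L j₁ i)) ⟨i, h⟩ (L * (j₂ ⟨i, h⟩ : ℕ) + (j₁ ⟨i, h⟩ : ℕ)) else 1

/-- the ordered product of the first `i` merged legs. [folklore] -/
def mergedAcc (S : Tor (fine L (fine n M)) → Fin d → (E →L[ℂ] E)) (y : Tor M) (j₂ : Fin d → Fin n) (j₁ : Fin d → Fin L) : ℕ → (E →L[ℂ] E)
  | 0 => 1
  | i + 1 => mergedAcc S y j₂ j₁ i * mergedLeg L n M S y j₂ j₁ i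

variable (S : Tor (fine L (fine n M)) → Fin d → (E →L[ℂ] E))

omit hM in
/-- all digits off: `below j 0 = 0`. [folklore] -/
theorem below_zero (j : Fin d → Fin L) : below L j 0 = 0 := by
  funext κ; simp [below]

omit [NeZero L] hM in
/-- the empty product. [folklore] -/
theorem outerRest_zero (y : Tor M) (j₂ : Fin d → Fin n) (b : Fin d → Fin L) (i : ℕ) : outerRest L n M S y j₂ b i 0 = 1 := rfl

omit [NeZero L] hM in
/-- `outerRest` unfolds on the left by definition. [folklore] -/
theorem outerRest_succ_left (y : Tor M) (j₂ : Fin d → Fin n) (b : Fin d → Fin L) (i m : ℕ) :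
    outerRest L n M S y j₂ b i (m + 1) = outerLeg L n M S y j₂ b i * outerRest L n M S y j₂ b (i + 1) m := rfl

omit [NeZero L] hM in
/-- prefixes of `outerRest` absorb one more leg on the right. [folklore] -/
theorem outerRest_succ_right (y : Tor M) (j₂ : Fin d → Fin n) (b : Fin d → Fin L) :
    ∀ (m i : ℕ), outerRest L n M S y j₂ b i (m + 1) = outerRest L n M S y j₂ b i m * outerLeg L n M S y j₂ b (i + m)
  | 0, i => by simp [outerRest]
  | m + 1, i => by
    rw [outerRest_succ_left L n M S y j₂ b i (m + 1), outerRest_succ_left L n M S y j₂ b i m, outerRest_succ_right y j₂ b m (i + 1), mul_assoc,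
      show i + 1 + m = i + (m + 1) by omega]

omit hM in
/-- **THE COARSE TAXI IS `outerRest` AT OFFSET `0`**: `taxiAcc n M (coarseTv S) y j₂ k = outerRest S y j₂ 0 0 k` (each coarse leg of `j₂ᵢ` coarse bonds is the fine run of
`L·j₂ᵢ` bonds from the base point of its corner site, `piTv_coarseTv_eq`). [folklore] -/
theorem taxiAcc_coarse_eq_outerRest (y : Tor M) (j₂ : Fin d → Fin n) :
    ∀ k : ℕ, taxiAcc n M (coarseTv L (fine n M) S) y j₂ k = outerRest L n M S y j₂ 0 0 k
  | 0 => rfl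
  | k + 1 => by
    rw [outerRest_succ_right, ← taxiAcc_coarse_eq_outerRest y j₂ k, Nat.zero_add]
    show taxiAcc n M (coarseTv L (fine n M) S) y j₂ k * legTv n M (coarseTv L (fine n M) S) y j₂ k = _
    congr 1
    unfold legTv outerLeg
    split_ifs with h
    · exact piTv_coarseTv_eq L n M S _ _ _
    · rfl

/-! ## §2 Moving a fine leg past the later coarse legs; the merge -/

variable {S} (hS : ∀ x μ, ‖S x μ‖ ≤ 1) {a : ℝ}
  (ha : ∀ x κ ι, ‖S x κ * S (x + unitVec (fine L (fine n M)) κ) ι - S x ι * S (x + unitVec (fine L (fine n M)) ι) κ‖ ≤ a)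
include hS ha

omit [NeZero L] hM in
/-- contractive legs. [folklore] -/
theorem norm_outerLeg_le_one (y : Tor M) (j₂ : Fin d → Fin n) (b : Fin d → Fin L) (i : ℕ) : ‖outerLeg L n M S y j₂ b i‖ ≤ 1 := by
  have := ha; unfold outerLeg; split_ifs
  · exact norm_piTv_le_one L (fine n M) hS _ _ _
  · exact ContinuousLinearMap.norm_id_le

omit [NeZero L] hM in
/-- contractive products of legs. [folklore] -/
theorem norm_outerRest_le_one (y : Tor M) (j₂ : Fin d → Fin n) (b : Fin d → Fin L) : ∀ (m i : ℕ), ‖outerRest L n M S y j₂ b i m‖ ≤ 1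
  | 0, _ => ContinuousLinearMap.norm_id_le
  | m + 1, i => by
    rw [outerRest]
    have h1 := norm_outerLeg_le_one L n M hS ha y j₂ b i
    have h2 := norm_outerRest_le_one y j₂ b m (i + 1)
    have h3 := norm_nonneg (outerRest L n M S y j₂ b (i + 1) m)
    exact (norm_mul_le _ _).trans (by nlinarith)

omit hM in
/-- contractive merged prefixes. [folklore] -/
theorem norm_mergedAcc_le_one (y : Tor M) (j₂ : Fin d → Fin n) (j₁ : Fin d → Fin L) : ∀ i : ℕ, ‖mergedAcc L n M S y j₂ j₁ i‖ ≤ 1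
  | 0 => ContinuousLinearMap.norm_id_le
  | i + 1 => by
    have ha' := ha
    rw [mergedAcc]
    have h1 : ‖mergedLeg L n M S y j₂ j₁ i‖ ≤ 1 := by
      unfold mergedLeg; split_ifs
      · exact norm_piTv_le_one L (fine n M) hS _ _ _
      · exact ContinuousLinearMap.norm_id_le
    have h2 := norm_mergedAcc_le_one y j₂ j₁ i
    have h3 := norm_nonneg (mergedLeg L n M S y j₂ j₁ i)
    exact (norm_mul_le _ _).trans (by nlinarith)

omit hM in
/-- **THE FINE LEG `i` MOVES LEFT PAST THE COARSE LEGS `i+1, …, i+m`**: with `P_q := bpt (corner y j₂ q) (below j₁ i)` and `P′_q := bpt (corner y j₂ q) (below j₁ (i+1))`,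
`‖outerRest(below j₁ i) (i+1) m ∘ Π^i_{j₁ᵢ}(P_{i+1+m}) − Π^i_{j₁ᵢ}(P_{i+1}) ∘ outerRest(below j₁ (i+1)) (i+1) m‖ ≤ m·(L(n−1)·j₁ᵢ)·a` (one `L j₂_q × j₁ᵢ` rectangle per leg). [folklore] -/
theorem outerRest_mul_innerLeg_sub_le (y : Tor M) (j₂ : Fin d → Fin n) (j₁ : Fin d → Fin L) {i : ℕ} (hid : i < d) :
    ∀ m : ℕ, ‖outerRest L n M S y j₂ (below L j₁ i) (i + 1) m
          * piTv L (fine n M) S (bpt L (fine n M) (corner n M y j₂ (i + 1 + m)) (below L j₁ i)) ⟨i, hid⟩ (j₁ ⟨i, hid⟩ : ℕ)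
        - piTv L (fine n M) S (bpt L (fine n M) (corner n M y j₂ (i + 1)) (below L j₁ i)) ⟨i, hid⟩ (j₁ ⟨i, hid⟩ : ℕ)
          * outerRest L n M S y j₂ (below L j₁ (i + 1)) (i + 1) m‖
      ≤ m * (((L : ℝ) * ((n - 1 : ℕ) : ℝ) * (j₁ ⟨i, hid⟩ : ℕ)) * a)
  | 0 => by simp [outerRest]
  | m + 1 => by
    have ha0 : 0 ≤ a := (norm_nonneg _).trans (ha (bpt L (fine n M) (corner n M y j₂ 0) 0) ⟨i, hid⟩ ⟨i, hid⟩)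
    have ih := outerRest_mul_innerLeg_sub_le y j₂ j₁ hid m
    -- the last coarse leg `q = i+1+m` and the rectangle through it
    set q := i + 1 + m with hq
    have hstep : ‖outerLeg L n M S y j₂ (below L j₁ i) q
          * piTv L (fine n M) S (bpt L (fine n M) (corner n M y j₂ (q + 1)) (below L j₁ i)) ⟨i, hid⟩ (j₁ ⟨i, hid⟩ : ℕ)
        - piTv L (fine n M) S (bpt L (fine n M) (corner n M y j₂ q) (below L j₁ i)) ⟨i, hid⟩ (j₁ ⟨i, hid⟩ : ℕ)
          * outerLeg L n M S y j₂ (below L j₁ (i + 1)) q‖ ≤ ((L : ℝ) * ((n - 1 : ℕ) : ℝ) * (j₁ ⟨i, hid⟩ : ℕ)) * a := by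
      unfold outerLeg
      split_ifs with hqd
      · -- the points: the leg ends at the next corner, the fine leg ends at the next offset
        have hP1 : bpt L (fine n M) (corner n M y j₂ (q + 1)) (below L j₁ i)
            = bpt L (fine n M) (corner n M y j₂ q) (below L j₁ i) + tstep (fine L (fine n M)) ⟨q, hqd⟩ (L * (j₂ ⟨q, hqd⟩ : ℕ)) := by
          rw [corner_succ n M y j₂ hqd, bpt_add_tstep_mul]
        have hiq : (⟨i, hid⟩ : Fin d) ≠ ⟨q, hqd⟩ := fun e => by have := congrArg Fin.val e; simp at this; omega
        have hP2 : bpt L (fine n M) (corner n M y j₂ q) (below L j₁ (i + 1))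
            = bpt L (fine n M) (corner n M y j₂ q) (below L j₁ i) + tstep (fine L (fine n M)) ⟨i, hid⟩ (j₁ ⟨i, hid⟩ : ℕ) := by
          have h0 : (below L j₁ i) ⟨i, hid⟩ = 0 := by simp [below]
          rw [below_succ L j₁ hid, bpt_update' L (fine n M) _ (below L j₁ i) ⟨i, hid⟩ (j₁ ⟨i, hid⟩)]
          rw [show Function.update (below L j₁ i) ⟨i, hid⟩ (0 : Fin L) = below L j₁ i from by rw [← h0, Function.update_eq_self]]
        rw [hP1, hP2]
        refine (norm_piTv_comm_sub_le L (fine n M) hS ha _ ⟨q, hqd⟩ ⟨i, hid⟩ (L * (j₂ ⟨q, hqd⟩ : ℕ)) (j₁ ⟨i, hid⟩ : ℕ)).trans ?_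
        have hj : ((j₂ ⟨q, hqd⟩ : ℕ) : ℝ) ≤ ((n - 1 : ℕ) : ℝ) := by exact_mod_cast Nat.le_sub_one_of_lt (j₂ ⟨q, hqd⟩).is_lt
        have h0' : (0 : ℝ) ≤ (L : ℝ) * (j₁ ⟨i, hid⟩ : ℕ) * a := by positivity
        push_cast
        nlinarith
      · rw [one_mul, mul_one]
        -- beyond `d` the corner no longer moves
        have hc : corner n M y j₂ (q + 1) = corner n M y j₂ q := by
          unfold corner; rw [VariationalTaxiTransport.below_of_le _ _ (by omega), VariationalTaxiTransport.below_of_le _ _ (by omega)]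
        rw [hc, sub_self, norm_zero]; positivity
    -- split off the last leg on both sides and insert the intermediate term
    rw [outerRest_succ_right, outerRest_succ_right]
    have e : outerRest L n M S y j₂ (below L j₁ i) (i + 1) m * outerLeg L n M S y j₂ (below L j₁ i) (i + 1 + m)
          * piTv L (fine n M) S (bpt L (fine n M) (corner n M y j₂ (i + 1 + (m + 1))) (below L j₁ i)) ⟨i, hid⟩ (j₁ ⟨i, hid⟩ : ℕ)
        - piTv L (fine n M) S (bpt L (fine n M) (corner n M y j₂ (i + 1)) (below L j₁ i)) ⟨i, hid⟩ (j₁ ⟨i, hid⟩ : ℕ)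
          * (outerRest L n M S y j₂ (below L j₁ (i + 1)) (i + 1) m * outerLeg L n M S y j₂ (below L j₁ (i + 1)) (i + 1 + m))
        = outerRest L n M S y j₂ (below L j₁ i) (i + 1) m
            * (outerLeg L n M S y j₂ (below L j₁ i) q
                * piTv L (fine n M) S (bpt L (fine n M) (corner n M y j₂ (q + 1)) (below L j₁ i)) ⟨i, hid⟩ (j₁ ⟨i, hid⟩ : ℕ)
              - piTv L (fine n M) S (bpt L (fine n M) (corner n M y j₂ q) (below L j₁ i)) ⟨i, hid⟩ (j₁ ⟨i, hid⟩ : ℕ)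
                * outerLeg L n M S y j₂ (below L j₁ (i + 1)) q)
          + (outerRest L n M S y j₂ (below L j₁ i) (i + 1) m
                * piTv L (fine n M) S (bpt L (fine n M) (corner n M y j₂ q) (below L j₁ i)) ⟨i, hid⟩ (j₁ ⟨i, hid⟩ : ℕ)
              - piTv L (fine n M) S (bpt L (fine n M) (corner n M y j₂ (i + 1)) (below L j₁ i)) ⟨i, hid⟩ (j₁ ⟨i, hid⟩ : ℕ)
                * outerRest L n M S y j₂ (below L j₁ (i + 1)) (i + 1) m)
            * outerLeg L n M S y j₂ (below L j₁ (i + 1)) q := by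
      rw [hq, show i + 1 + (m + 1) = i + 1 + m + 1 by omega]
      simp only [mul_sub, sub_mul, mul_assoc]; abel
    rw [e]
    calc _ ≤ ‖outerRest L n M S y j₂ (below L j₁ i) (i + 1) m‖ * (((L : ℝ) * ((n - 1 : ℕ) : ℝ) * (j₁ ⟨i, hid⟩ : ℕ)) * a)
          + m * (((L : ℝ) * ((n - 1 : ℕ) : ℝ) * (j₁ ⟨i, hid⟩ : ℕ)) * a) * ‖outerLeg L n M S y j₂ (below L j₁ (i + 1)) q‖ := by
          refine (norm_add_le _ _).trans (add_le_add ?_ ?_)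
          · exact (norm_mul_le _ _).trans (mul_le_mul_of_nonneg_left hstep (norm_nonneg _))
          · exact (norm_mul_le _ _).trans (mul_le_mul_of_nonneg_right ih (norm_nonneg _))
      _ ≤ 1 * (((L : ℝ) * ((n - 1 : ℕ) : ℝ) * (j₁ ⟨i, hid⟩ : ℕ)) * a) + m * (((L : ℝ) * ((n - 1 : ℕ) : ℝ) * (j₁ ⟨i, hid⟩ : ℕ)) * a) * 1 := by
          gcongr
          · exact norm_outerRest_le_one L n M hS ha y j₂ _ m (i + 1)
          · exact norm_outerLeg_le_one L n M hS ha y j₂ _ q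
      _ = ((m + 1 : ℕ) : ℝ) * (((L : ℝ) * ((n - 1 : ℕ) : ℝ) * (j₁ ⟨i, hid⟩ : ℕ)) * a) := by push_cast; ring

omit hM in
/-- **THE MERGE, PREFIX FORM** (`M_i`): `‖outerRest 0 0 d ∘ taxiAcc_in i − mergedAcc i ∘ outerRest (below j₁ i) i (d − i)‖ ≤ i·d·L(n−1)(L−1)·a` — the first `i` fine legs
have been moved into place and merged, the coarse legs `≥ i` wait at the offset `below j₁ i`. [folklore] -/
theorem outer_mul_innerAcc_sub_le (y : Tor M) (j₂ : Fin d → Fin n) (j₁ : Fin d → Fin L) :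
    ∀ {i : ℕ}, i ≤ d →
      ‖outerRest L n M S y j₂ 0 0 d * taxiAcc L (fine n M) S (bpt n M y j₂) j₁ i
          - mergedAcc L n M S y j₂ j₁ i * outerRest L n M S y j₂ (below L j₁ i) i (d - i)‖
        ≤ (i : ℝ) * ((d : ℝ) * (((L : ℝ) * ((n - 1 : ℕ) : ℝ) * ((L - 1 : ℕ) : ℝ)) * a))
  | 0, _ => by simp [taxiAcc, mergedAcc, below_zero]
  | i + 1, hi => by
    have hid : i < d := Nat.lt_of_succ_le hi
    have ha0 : 0 ≤ a := (norm_nonneg _).trans (ha (bpt L (fine n M) (corner n M y j₂ 0) 0) ⟨i, hid⟩ ⟨i, hid⟩)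
    have ih := outer_mul_innerAcc_sub_le y j₂ j₁ hid.le
    set m := d - (i + 1) with hm
    have hdi : d - i = m + 1 := by omega
    rw [hdi] at ih
    -- names
    set bi := below L j₁ i with hbi
    set Pend := piTv L (fine n M) S (bpt L (fine n M) (corner n M y j₂ (i + 1 + m)) bi) ⟨i, hid⟩ (j₁ ⟨i, hid⟩ : ℕ) with hPend
    set Pstart := piTv L (fine n M) S (bpt L (fine n M) (corner n M y j₂ (i + 1)) bi) ⟨i, hid⟩ (j₁ ⟨i, hid⟩ : ℕ) with hPstart
    -- the inner leg `i` is `Pend` (the inner taxi is based at the last coarse corner)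
    have hleg : legTv L (fine n M) S (bpt n M y j₂) j₁ i = Pend := by
      simp only [legTv, dif_pos hid, hPend, corner, hbi, ← corner_d n M y j₂, show i + 1 + m = d by omega]
    -- the merged leg `i` is the coarse leg followed by `Pstart`
    have hmerged : mergedLeg L n M S y j₂ j₁ i = outerLeg L n M S y j₂ bi i * Pstart := by
      simp only [mergedLeg, outerLeg, dif_pos hid, hPstart, hbi]
      rw [corner_succ n M y j₂ hid, bpt_add_tstep_mul, ← piTv_add]
    -- the commutation of the inner leg past the coarse legs `i+1, …, d-1`
    have hK := outerRest_mul_innerLeg_sub_le L n M hS ha y j₂ j₁ hid m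
    -- algebra
    have e : outerRest L n M S y j₂ 0 0 d * taxiAcc L (fine n M) S (bpt n M y j₂) j₁ (i + 1)
          - mergedAcc L n M S y j₂ j₁ (i + 1) * outerRest L n M S y j₂ (below L j₁ (i + 1)) (i + 1) m
        = (outerRest L n M S y j₂ 0 0 d * taxiAcc L (fine n M) S (bpt n M y j₂) j₁ i
              - mergedAcc L n M S y j₂ j₁ i * outerRest L n M S y j₂ bi i (m + 1)) * Pend
          + mergedAcc L n M S y j₂ j₁ i * outerLeg L n M S y j₂ bi i
              * (outerRest L n M S y j₂ bi (i + 1) m * Pend - Pstart * outerRest L n M S y j₂ (below L j₁ (i + 1)) (i + 1) m) := by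
      rw [taxiAcc, hleg, mergedAcc, hmerged, outerRest_succ_left]
      simp only [mul_sub, sub_mul, mul_assoc]; abel
    rw [e]
    have hn1 : ‖mergedAcc L n M S y j₂ j₁ i * outerLeg L n M S y j₂ bi i‖ ≤ 1 := by
      have h1 := norm_mergedAcc_le_one L n M hS ha y j₂ j₁ i
      have h2 := norm_outerLeg_le_one L n M hS ha y j₂ bi i
      have h3 := norm_nonneg (outerLeg L n M S y j₂ bi i)
      exact (norm_mul_le _ _).trans (by nlinarith)
    have hPend1 : ‖Pend‖ ≤ 1 := norm_piTv_le_one L (fine n M) hS _ _ _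
    have hj : ((j₁ ⟨i, hid⟩ : ℕ) : ℝ) ≤ ((L - 1 : ℕ) : ℝ) := by exact_mod_cast Nat.le_sub_one_of_lt (j₁ ⟨i, hid⟩).is_lt
    have hm_le : (m : ℝ) ≤ d := by exact_mod_cast (show m ≤ d by omega)
    have hB0 : 0 ≤ ((L : ℝ) * ((n - 1 : ℕ) : ℝ) * ((L - 1 : ℕ) : ℝ)) * a := by positivity
    calc _ ≤ (i : ℝ) * ((d : ℝ) * (((L : ℝ) * ((n - 1 : ℕ) : ℝ) * ((L - 1 : ℕ) : ℝ)) * a)) * ‖Pend‖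
          + 1 * (m * (((L : ℝ) * ((n - 1 : ℕ) : ℝ) * (j₁ ⟨i, hid⟩ : ℕ)) * a)) := by
          refine (norm_add_le _ _).trans (add_le_add ?_ ?_)
          · exact (norm_mul_le _ _).trans (mul_le_mul_of_nonneg_right ih (norm_nonneg _))
          · exact (norm_mul_le _ _).trans (mul_le_mul hn1 hK (norm_nonneg _) zero_le_one)
      _ ≤ (i : ℝ) * ((d : ℝ) * (((L : ℝ) * ((n - 1 : ℕ) : ℝ) * ((L - 1 : ℕ) : ℝ)) * a)) * 1
          + 1 * (d * (((L : ℝ) * ((n - 1 : ℕ) : ℝ) * ((L - 1 : ℕ) : ℝ)) * a)) := by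
          gcongr
      _ = ((i + 1 : ℕ) : ℝ) * ((d : ℝ) * (((L : ℝ) * ((n - 1 : ℕ) : ℝ) * ((L - 1 : ℕ) : ℝ)) * a)) := by push_cast; ring

omit hM in
/-- **MERGING TWO TAXIS**: the coarse taxi to the site `n·y + j₂` (legs of `L·j₂ᵢ` fine bonds) followed by the fine taxi inside that site (legs `j₁ᵢ`) is the straight taxi
with legs `L·j₂ᵢ + j₁ᵢ`, up to `d²·L(n−1)(L−1)·a`:
`‖taxiAcc n M (coarseTv S) y j₂ d ∘ taxiAcc L (fine n M) S (n·y + j₂) j₁ d − mergedAcc S y j₂ j₁ d‖ ≤ d·d·L(n−1)(L−1)·a`. [folklore] -/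
theorem outer_mul_inner_sub_mergedAcc_le (y : Tor M) (j₂ : Fin d → Fin n) (j₁ : Fin d → Fin L) :
    ‖taxiAcc n M (coarseTv L (fine n M) S) y j₂ d * taxiAcc L (fine n M) S (bpt n M y j₂) j₁ d - mergedAcc L n M S y j₂ j₁ d‖
      ≤ (d : ℝ) * ((d : ℝ) * (((L : ℝ) * ((n - 1 : ℕ) : ℝ) * ((L - 1 : ℕ) : ℝ)) * a)) := by
  have h := outer_mul_innerAcc_sub_le L n M hS ha y j₂ j₁ (le_refl d)
  rw [Nat.sub_self, outerRest_zero, mul_one] at h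
  rw [taxiAcc_coarse_eq_outerRest]
  exact h

end Summit.QuantumFields.BalabanUV.T4Continuum.VariationalColourTaxiTransport

end
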